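import Summits.AtomisticToContinuum.Crystallization.Theorems.ChartedZeroExcessLayeredLatticeLiouvilleC

/-!
# ChartedZeroExcessLayered · LatticeLiouville — part D/8: §C‴ the two typed halves of N″(Λ, θ), §C⁗ the shared tolerance κ (decomp-a2c lens-2 g24 `LatticeLiouville.lean` v8 sha256 4defadc6…, lines 844–1065,
split at the `##` / `###` doc-heading boundaries for the gate's 400-line limit (cut table of critic row 444, §C cut once more at §C‴); content byte-identical; ONE
namespace `…Theorems.ChartedZeroExcessLayeredLatticeLiouville` across the parts, linear import chain.
-/

noncomputable section

open scoped BigOperators InnerProductSpace RealInnerProductSpace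
open MeasureTheory Set Metric
open Summit.AtomisticToContinuum.Crystallization.Theorems.ChartedPlanarOrderRigidityDoor (E3 IsClean IsNash IsCharted VisibleGap PertRegime atomsIn)
open Summit.AtomisticToContinuum.Crystallization.Theorems.ChartedPlanarOrderDensityDichotomy (μS IsSep)
open Summit.AtomisticToContinuum.Crystallization.Theorems.ChartedPlanarOrderMesoCut (IsDoorSet NearHom LayeredHom EnvClose)
open Summit.AtomisticToContinuum.Crystallization.Theorems.OverbindingBudgetLiouvilleDictionary (NearHomBD nearHom_of_nearHomBD)
open Summit.AtomisticToContinuum.Crystallization.Theorems.ChartedPlanarOrderDoorLayered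
  (TwoPeriodic not_twoPeriodic_singleton DoorHomogeneityBD DoorPeriodic PeriodicBulkGapDoor PeriodicBulkGap
   doorPeriodic_of_doorHomogeneityBD gap_and_pert_1_50_of_periodic gap_and_pert_1_50_of_periodic'
   NearHomL2BD CleanScaleCoherenceL2BD FlatnessExactL2BD doorPeriodic_of_L2 cleanScaleCoherenceL2BD_of_large nearHomL2BD_mono Layered)
open Summit.AtomisticToContinuum.Crystallization.Theorems.ChartedPlanarOrderDoorLayeredOsc
  (IsTwoShellAffineGood OscillationImprovement DoorPeriodicOsc doorPeriodic_of_osc doorPeriodicOsc_of_doorPeriodic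
   oscillationImprovement_of_ge)
open Literature.MathematicalPhysics.StatisticalMechanics (triangularVec₁ triangularVec₂)

namespace Summit.AtomisticToContinuum.Crystallization.Theorems.ChartedZeroExcessLayeredLatticeLiouville

/-! ### §C‴  The two typed halves of N″(Λ, θ) over lens-3's L²-currency (tree `…DoorLayered` §3: `NearHomL2BD Λ κ r S Q`, K_A²_BD
`CleanScaleCoherenceL2BD Λ κ`, K_B²♮ `FlatnessExactL2BD Λ κ`, seam `doorPeriodic_of_L2`; ONE currency, nothing re-declared).  lens-3's split beneath
L1′♮ is `K_A²_BD(Λ, κ) ∧ K_B²♮(Λ, κ) ⟹ DoorPeriodic Λ` at every SHARED κ.  The perturbative transfer N″(Λ, θ) is the SAME split with both halves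
RESTRICTED to oscillation ≤ θ and the K_B² half FED by the linear Liouville certificate — which types exactly where `LatticeLiouvilleCert` is consumed
(the excess-decay half, never the rigidity half):  R(Λ, θ, κ) ∧ P(Λ, θ, κ) ⟹ N″(Λ, θ) (`nonlinearTransferOsc_of_L2`, PROVED), with lens-3's pieces
giving mine by dropping hypotheses (`oscRigidityL2BD_of_cleanScaleCoherence`, `linearisedFlatnessExact_of_flatnessExact`).  Literal of record for the
shared mean-square tolerance: κ(θ) = 4·θ² (KORN column C_rig ≈ 2.0, census TAG 138′, critic row 414 (1)(c)), i.e. θ_osc = 1/32 ↦ κ = 1/256.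
(v8 ERRATUM, census TAG 158: C_rig multiplies the CLEAN gradient tolerance 1/32 (× environment radius 4), not θ — the rigidity level is
κ_rig = C_rig²·(1/8)² = 1/16; the literals of record are now R at κ₁ = 1/16 and P/P♭ at κ₀ = 4θ² = 1/64, joined by D `OscFlatnessDecay`, §C⁗/§D″.) -/

/-- **R(Λ, θ, κ) «OscRigidityL2BD Λ θ κ»** — MULTISCALE RIGIDITY for door sets of oscillation ≤ θ (energy-free AND equation-free; the
oscillation-restricted form of lens-3's K_A²_BD): every root window `atomsIn (μS S) 0 R` of a door set all of whose atoms are `θ`-affine-good is near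
ONE homogeneously deformed layered structure `LayeredHom L w` (chart distortion ≤ Λ) IN MEAN SQUARE ≤ κ at radius 4 — uniformly in `R`.  Mechanism:
pointwise the local affine part `T_q` lies within `θ + 1/16`-type distance of the similarity well `[9/10, 1]·SO(3)·{fcc, hcp two-shell}`; geometric
rigidity for the (conformal-type) similarity well in d = 3 (Friesecke–James–Müller L²-rigidity for SO(3); Reshetnyak / Faraco–Zhong for `ℝ₊·SO(3)`;
Liouville's theorem: a Möbius map with two-sided bounded dilation is a similarity) makes the window mean-square distance to ONE affine near-similarity
≲ κ_rig := C_rig²·(4·(1/32))² — the RIGIDITY LEVEL set by the CLEAN gradient tolerance 1/32, NOT by θ (v8 ERRATUM, census TAG 158 / §C⁗: the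
θ-hypothesis bounds second differences only) — scale-independently; the layered target absorbs the free fcc/hcp stacking letter per layer (no two-well issue at the level of
`LayeredHom`).  ANTI-monotone in θ, MONOTONE in κ; FREE for κ ≥ 16 (`oscRigidityL2BD_of_large`, tree calibration (w0)) — RIGIDITY content for κ_rig ≤ κ < 16
(κ_rig = 1/16 at C_rig = 2, ≤ 1 for C_rig ≤ 8; REGISTERED at κ₁ = 1/16, v8); BELOW κ_rig R additionally carries LARGE-SCALE OSCILLATION DECAY — the
N″-core, named `OscFlatnessDecay` in §C⁗ and registered separately (census TAG 158).
Nearest print (presearch 2026-08-31): A. T. Gaál, «Long-range orientational order of a random near lattice hard sphere and hard disk process»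
[galaxy:pdf:771971160] — point configurations LOCALLY close to a lattice inherit GLOBAL orientational order via Friesecke–James–Müller rigidity
transferred to point sets through local triangulations (the SO(3) well; the similarity/layered well of R is not covered there); FJM variants
[galaxy:pdf:-8215313241452604520] (Conti–Dolzmann–Müller, mixed growth); conformal-well rigidity (Faraco–Zhong 2005, cite-level: no corpus/galaxy
hit for "rigidity of conformal matrices|Faraco and Zhong").
ROUTE TO A SCALE-INDEPENDENT CONSTANT (v8, critic row 433 (B) «R = ATTACKABLE·L, nested-radii route to the docstring»): work at two NESTED radii
`B_R ⊂ B_{CR}` of the same root window.  On `B_{CR}` every atom is `θ`-affine-good and clean, so the local affine parts range in the similarity well with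
TWO-SIDED dilation in `[9/10, 103/100]`; conformal-well rigidity (Reshetnyak stability / Faraco–Zhong, cite-level) puts the window L²-close to ONE
Möbius map `φ` on `B_{CR}`; a Möbius map whose dilation stays within the ratio `(103/100)/(9/10)` over ALL of `B_{CR}` has its pole at distance
`ρ ≳ C·R` (dilation ratio across the ball `((ρ + CR)/(ρ − CR))²`), hence `∇φ` varies by `O(CR/ρ) = O(1/C)` over `B_R`: on the inner ball `φ` is within
`O(1/C)` of ONE similarity, so `misfit(B_R) ≤ κ_rig + O(1/C²)` with `C` chosen once — uniformly in `R`, no `log R`.  `IsCharted` is consumed in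
the layered part (one close-packed layer family per root window).  SCALE TOLERANCE to `[9/10, 103/100]`: YES — at the chart step (`‖L‖, ‖L⁻¹‖ ≤ Λ = 2`
absorbs any local spacing of the clean window; the similarity well is scale-free).
Why it might fail: a scale-INDEPENDENT constant needs the quantitative L²-rigidity for the similarity well WITH the two-sided dilation constraint
(conformal rigidity alone allows Möbius drift inside one window before the dilation bound bites at larger scales — the constant could degrade
like log R between the scale where conformal rigidity acts and the scale where the dilation range [9/10, 1] excludes inversion); cite-level, not
located in print in this exact form.  Cheapest falsifier: a (1/32)-affine-good finite clean patch whose best single-chart mean-square misfit at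
radius 4 over root windows grows with R (census: KORN column run on the CAMP-rearranged interiors, TAG 154 data).  RUN as TAG 158 KORN-R (census g14
2026-08-31T11:10Z, KORN158.md on stmt-26636): on the clamped CAMP balls θ_q does NOT control the single-chart window misfit (κ_emp = 10–240 × 4θ²,
governed by the clamp-imposed harmonic long wave; hcp misfit grows mildly with R) — NO kill on door sets (finite clamped balls are not door sets), but
the registration of R at κ = 4θ² is WITHDRAWN: v8 registers R at the rigidity level κ₁ = 1/16 and names the decay below it (§C⁗). -/
def OscRigidityL2BD (Λ θ κ : ℝ) : Prop :=
  ∀ δ : ℝ, 0 < δ → ∀ S : Set E3, IsDoorSet δ S → (∀ q ∈ S, IsTwoShellAffineGood θ S q) →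
    ∀ R : ℝ, 0 < R → NearHomL2BD Λ κ 4 S (atomsIn (μS S) 0 R)

/-- **P(Λ, θ, κ) «LinearisedFlatnessExact Λ θ κ»** — the PERTURBATIVE EXCESS DECAY fed by the linear Liouville certificate (the
oscillation-restricted, certificate-fed form of lens-3's K_B²♮ `FlatnessExactL2BD`): GIVEN `LatticeLiouvilleCert`, a door set of oscillation ≤ θ all
of whose root windows are κ-coherent in mean square is EXACTLY two-periodic.  Mechanism = N′ schema (ii)+(iii) with (i) split off into R:
Campanato iteration DOWN the scales — linearise the Nash equations at the window's own layered chart; a non-improving sequence of windows blows up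
to a bounded-gradient `ljKernel`-harmonic field on a clean STABLE crystal, affine by `LatticeLiouvilleCert` ⇒ misfit(R/M) ≤ ½·misfit(R) + C·misfit(R)²
while misfit ≤ κ₀; since R supplies misfit ≤ κ UNIFORMLY IN R, letting R → ∞ gives misfit 0 at every finite radius ⇒ exactly `LayeredHom` ⇒
`TwoPeriodic Λ` (no blow-DOWN limit is ever taken: the bounded-gradient endpoint danger of N″ is confined to R's uniformity).  ANTI-monotone in θ,
ANTI-monotone in κ (larger κ = weaker hypothesis = stronger claim); implied by lens-3's K_B²♮ outright (`linearisedFlatnessExact_of_flatnessExact`).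
Why it might fail: (a) the linearisation point is the window's layered chart `LayeredHom L w` whose stacking sequence `w` need NOT be periodic,
while `LatticeLiouvilleCert` (§B) certifies clean STABLE PERIODIC multilattices (Barlow stackings of any finite period): an APERIODIC Barlow
stacking's linearised operator is covered only through a limit over periodic approximants / lens-3's layer-chain kernel E1 (k∥ = 0) — the first
typed gap of this half; (b) the contraction needs oscillation inside the elastic basin — exactly what θ ≤ 1/32 buys (census CAMP column).
(v8: gap (a) is DISSOLVED in §D — P ⟸ P♭ `LinearisedFlatnessLayered` ∧ L_lay `LayeredLiouvilleCert`, the linear Liouville theorem for layered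
structures of ANY stacking word, `linearisedFlatnessExact_of_layered` PROVED.)  SCALE TOLERANCE to `[9/10, 103/100]`: YES — at the linearisation step
(the window's own layered chart of any spacing; the certificate is evaluated at the structure's own Nash scale).
Cheapest falsifier: TAG 138′ CAMP contraction factor ≥ 1 at oscillation 1/32 for some clean Nash window, or an aperiodic-stacking soft mode
(layer-chain symbol of lens-3's E1 vanishing at some k∥ ≠ 0 boundary of the periodic family). -/
def LinearisedFlatnessExact (Λ θ κ : ℝ) : Prop :=
  LatticeLiouvilleCert → ∀ δ : ℝ, 0 < δ → ∀ S : Set E3, IsDoorSet δ S → (∀ q ∈ S, IsTwoShellAffineGood θ S q) →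
    (∀ R : ℝ, 0 < R → NearHomL2BD Λ κ 4 S (atomsIn (μS S) 0 R)) → TwoPeriodic Λ S

/-- ★ **the seam beneath N″(Λ, θ): R(Λ, θ, κ) ∧ P(Λ, θ, κ) ⟹ N″(Λ, θ)** at every shared κ (PROVED; the certificate is routed into P only). -/
theorem nonlinearTransferOsc_of_L2 {Λ θ κ : ℝ} (hRig : OscRigidityL2BD Λ θ κ) (hP : LinearisedFlatnessExact Λ θ κ) :
    NonlinearTransferOsc Λ θ :=
  fun hL δ hδ S hS hO => hP hL δ hδ S hS hO (fun R hR => hRig δ hδ S hS hO R hR)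

/-- lens-3's K_A²_BD gives R at every θ (drop the oscillation hypothesis): R is the WEAKER rigidity statement. -/
theorem oscRigidityL2BD_of_cleanScaleCoherence {Λ θ κ : ℝ} (h : CleanScaleCoherenceL2BD Λ κ) : OscRigidityL2BD Λ θ κ :=
  fun δ hδ S hS _ R hR => h δ hδ S hS R hR

/-- lens-3's K_B²♮ gives P at every θ and WITHOUT the certificate: P is the WEAKER decay statement. -/
theorem linearisedFlatnessExact_of_flatnessExact {Λ θ κ : ℝ} (h : FlatnessExactL2BD Λ κ) : LinearisedFlatnessExact Λ θ κ :=
  fun _ δ hδ S hS _ hW => h δ hδ S hS hW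

/-- R is ANTI-monotone in θ and MONOTONE in κ. -/
theorem OscRigidityL2BD.anti_mono {Λ θ θ' κ κ' : ℝ} (hθ : θ ≤ θ') (hκ : κ ≤ κ') (h : OscRigidityL2BD Λ θ' κ) :
    OscRigidityL2BD Λ θ κ' :=
  fun δ hδ S hS hO R hR => nearHomL2BD_mono hκ (h δ hδ S hS (fun q hq => (hO q hq).mono hθ) R hR)

/-- P is ANTI-monotone in θ and ANTI-monotone in κ. -/
theorem LinearisedFlatnessExact.anti_anti {Λ θ θ' κ κ' : ℝ} (hθ : θ ≤ θ') (hκ : κ ≤ κ') (h : LinearisedFlatnessExact Λ θ' κ') :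
    LinearisedFlatnessExact Λ θ κ :=
  fun hL δ hδ S hS hO hW => h hL δ hδ S hS (fun q hq => (hO q hq).mono hθ) (fun R hR => nearHomL2BD_mono hκ (hW R hR))

/-- **calibration (w0)**: R is FREE for κ ≥ 16 (tree `cleanScaleCoherenceL2BD_of_large`): at large κ the whole content of the pair sits in P,
at κ ~ 4θ² it is shared — the literal of record. -/
theorem oscRigidityL2BD_of_large {Λ θ κ : ℝ} (hΛ : 1 ≤ Λ) (hκ : 16 ≤ κ) : OscRigidityL2BD Λ θ κ :=
  oscRigidityL2BD_of_cleanScaleCoherence (cleanScaleCoherenceL2BD_of_large hΛ hκ)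

/-- **the full perturbative chain at the literals of record Λ₀ = 2, θ_osc = 1/32, κ = 1/256 — SEVEN typed leaves:
L1′♮(2) ⟸ LJDecay ∧ LJMoments ∧ CleanCrystalStability ∧ R(2, 1/32, 1/256) ∧ P(2, 1/32, 1/256) ∧ OscillationImprovement (1/32)**. -/
theorem doorPeriodic_of_pieces_L2 (hD : LJDecay) (hM : LJMoments) (hC : CleanCrystalStability) (hR : OscRigidityL2BD 2 (1 / 32) (1 / 256))
    (hP : LinearisedFlatnessExact 2 (1 / 32) (1 / 256)) (hB : OscillationImprovement (1 / 32)) : DoorPeriodic 2 :=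
  doorPeriodic_of_pieces_osc hD hM hC (nonlinearTransferOsc_of_L2 hR hP) hB

/-- ★ **THE (β) COLUMN, PERTURBATIVE BRANCH, FULLY RESOLVED INTO TYPED LEAVES** (seven Liouville-side leaves + HBG″):
`LJDecay → LJMoments → CleanCrystalStability → OscRigidityL2BD 2 (1/32) (1/256) → LinearisedFlatnessExact 2 (1/32) (1/256) →
OscillationImprovement (1/32) → PeriodicBulkGapDoor 2 → VisibleGap (1/50) ∧ PertRegime (1/50)`. -/
theorem gap_and_pert_1_50_of_liouville_pieces_L2 (hD : LJDecay) (hM : LJMoments) (hC : CleanCrystalStability)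
    (hR : OscRigidityL2BD 2 (1 / 32) (1 / 256)) (hP : LinearisedFlatnessExact 2 (1 / 32) (1 / 256))
    (hB : OscillationImprovement (1 / 32)) (hG : PeriodicBulkGapDoor 2) : VisibleGap (1 / 50) ∧ PertRegime (1 / 50) :=
  gap_and_pert_1_50_of_periodic (doorPeriodic_of_pieces_L2 hD hM hC hR hP hB) hG

/-- ★ **v8 REGISTRATION LITERAL** (critic row 433 (B)): the perturbative (β) column at the clean tolerance θ = 1/16 — BOOTSTRAP-FREE
(`nonlinearTransferOsc_iff_exact_of_ge`), κ(1/16) = 4·(1/16)² = 1/64 ≪ 16 (R contentful: `oscRigidityL2BD_of_large` needs κ ≥ 16) — SIX typed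
Liouville-side leaves: `L1′♮(2) ⟸ LJDecay ∧ LJMoments ∧ CleanCrystalStability ∧ R(2, 1/16, 1/64) ∧ P(2, 1/16, 1/64)`; the seven-leaf
θ_osc = 1/32 column above is kept as the FALLBACK literal. -/
theorem doorPeriodic_of_pieces_L2_16 (hD : LJDecay) (hM : LJMoments) (hC : CleanCrystalStability) (hR : OscRigidityL2BD 2 (1 / 16) (1 / 64))
    (hP : LinearisedFlatnessExact 2 (1 / 16) (1 / 64)) : DoorPeriodic 2 :=
  doorPeriodic_of_pieces hD hM hC ((nonlinearTransferOsc_iff_exact_of_ge le_rfl).1 (nonlinearTransferOsc_of_L2 hR hP))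

/-- ★ **THE (β) COLUMN AT THE v8 REGISTRATION LITERALS (2, 1/16, 1/64), six Liouville-side leaves + HBG″:**
`LJDecay → LJMoments → CleanCrystalStability → OscRigidityL2BD 2 (1/16) (1/64) → LinearisedFlatnessExact 2 (1/16) (1/64) → PeriodicBulkGapDoor 2 →
VisibleGap (1/50) ∧ PertRegime (1/50)` (its aperiodic-resolved form is §D′ `gap_and_pert_1_50_of_layered_pieces_16`). -/
theorem gap_and_pert_1_50_of_liouville_pieces_L2_16 (hD : LJDecay) (hM : LJMoments) (hC : CleanCrystalStability)
    (hR : OscRigidityL2BD 2 (1 / 16) (1 / 64)) (hP : LinearisedFlatnessExact 2 (1 / 16) (1 / 64)) (hG : PeriodicBulkGapDoor 2) :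
    VisibleGap (1 / 50) ∧ PertRegime (1 / 50) :=
  gap_and_pert_1_50_of_periodic (doorPeriodic_of_pieces_L2_16 hD hM hC hR hP) hG

/-! ### §C⁗ (v8, census TAG 158 KORN-R) — the shared tolerance κ HONESTLY placed: R at the RIGIDITY level κ₁, P/P♭ at the BASIN level κ₀, and the
named middle piece D «OscFlatnessDecay» (large-scale oscillation decay from κ₁ to κ₀)

ERRATUM to §C‴'s literal «κ(θ) = 4θ²»: the local hypothesis `IsTwoShellAffineGood θ S q` bounds the NON-AFFINE part of `q`'s two-shell environment
(discrete SECOND differences ≤ θ) against an ARBITRARY affine image `T` (critic row 433); it does not place `T` closer to the similarity well than the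
CLEAN tolerance does (gradient tolerance ≈ 1/32 at two shells).  Geometric rigidity (FJM / Reshetnyak / Faraco–Zhong + nested radii, R's mechanism)
therefore delivers window flatness at the RIGIDITY LEVEL κ_rig := C_rig²·(4·(1/32))² — κ_rig = 1/16 at the census Korn constant C_rig = 2 (TAG 138′),
κ_rig ≤ 1 for C_rig ≤ 8 — and NOT at 4θ²: below κ_rig, «flat at EVERY scale uniformly in R» asks that the gradient oscillation across a window of any
size be controlled by the second differences at unit scale, i.e. it EXCLUDES SLOWLY MODULATED LONG WAVES — Liouville-type content (census TAG 158,
g14 11:10Z, on the clamped CAMP balls of TAG 154: θ_q,max = 0.010–0.028 fcc / 0.0065–0.017 hcp, single-chart window misfit κ_emp(R) = 10–240 × 4θ²,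
governed by the clamp-imposed harmonic long wave, mildly growing with R for hcp; finite clamped balls are not door sets, so NO kill of R — but the
hypothesis does not control the conclusion's quantity two orders of magnitude over).  Census's two repairs — (i) strengthen R's hypothesis to a
WINDOW-scale oscillation bound, (ii) weaken R's conclusion to an r_env-local misfit — both collapse the split ((i) makes the window bound a new
un-supplied piece, (ii) makes R a bookkeeping lemma and P the whole of N″).  (Critic row 441 (A), 11:22Z, ruled the same independently: R re-tagged N″-STRENGTH at κ = 4θ², registration
WITHHELD pending a re-cut — (2a) R ⟸ R_loc [kinematic] ∧ R_dec [decay, N″-strength, NAMED] or (2b) decay into P; exactly ONE piece N″-strength.)  The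
re-cut taken here is (iii) = (2a) with the kinematic piece WINDOW-UNIFORM: R keeps its statement but is REGISTERED at
κ₁ = κ_rig (pure rigidity, θ-hypothesis unused — `oscRigidityL2BD_of_cleanScaleCoherence`), P/P♭ stay at the basin level κ₀ = 4θ² (ε-regularity),
and the gap between them is NAMED:

  D(Λ, θ, κ₁, κ₀) «OscFlatnessDecay»: a door set of oscillation ≤ θ that is κ₁-flat at every root-window scale is κ₀-flat at every root-window scale.

D is the LARGE-SCALE HALF of the nonlinear Liouville theorem at MODERATE oscillation (RMS gradient deviation from 1/16-type down to 1/32-type):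
WEAKER in content than N″/L1′♮ (an exactly two-periodic door set is 0-flat under its own layered chart — bridge B, distortion `4Λ + 13Λ/δ²`; not
typed here) and WEAKER than R(κ₀) outright (`oscFlatnessDecay_of_oscRigidity`), TRIVIAL for κ₁ ≤ κ₀
(`oscFlatnessDecay_of_le`), composes `R(κ₁) ∧ D(κ₁, κ₀) ⟹ R(κ₀)` (`oscRigidityL2BD_of_decay`).  TAG: UNDECIDED · TRUE-type · the N″-CORE made
visible (was hidden in R(4θ²)) · CENSUS-ABLE.  Mechanism if true: the SAME linearise-and-improve contraction as P, run from the rigidity level —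
i.e. D holds as soon as P's contraction basin (TAG 154: affine-projected contraction 0.036 fcc / 0.040 hcp, tested up to pointwise misfit 0.035)
reaches RMS environment misfit √κ₁ (= 1/4 at κ₁ = 1/16) — in which case D ∧ P♭ merge into P♭(κ₁) (`_16r` column below).  Why it might fail: entire
sitewise-Nash CLEAN configurations whose strain is slowly modulated INSIDE the clean well with RMS gradient oscillation between 1/32 and 1/16 at
large scales — excluded for energy MINIMISERS by the incompatibility (rank-one-freeness) of the similarity well, open for sitewise critical points;
equivalently the contraction may fail between pointwise misfit 0.035 (tested) and RMS misfit 1/4 (untested).  Cheapest falsifier (census ask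
KORN-R II): CAMP affine-projected contraction factor ≥ 1 on clean fcc/hcp balls seeded with a smooth random strain modulation of RMS gradient
amplitude 1/16 (environment misfit ≈ 1/4), wavelength ≥ 8a.  Presearch: "geometric rigidity conformal|Reshetnyak stability theorem|Möbius" galaxy pdf
→ FZ-type rigidity cite-level only (R's docstring); "Liouville theorem nonlinear elasticity entire solutions|equilibrium bounded gradient" → no
corpus/galaxy hit for sitewise-critical configurations (minimiser-side only: quasiconvexity literature); `lean search 'OscFlatnessDecay|FlatnessDecay'`
→ no hits. -/

/-- **D(Λ, θ, κ₁, κ₀) «OscFlatnessDecay Λ θ κ₁ κ₀»** — LARGE-SCALE OSCILLATION DECAY: for a door set all of whose atoms are `θ`-affine-good,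
κ₁-flatness of EVERY root window (mean-square environment misfit ≤ κ₁ against ONE layered chart of distortion ≤ Λ per window) improves to
κ₀-flatness of every root window.  MONOTONE in κ₀, ANTI-monotone in κ₁ and θ; trivial for κ₁ ≤ κ₀; the registered literals are
(2, 1/16, 1/16, 1/64): from the rigidity level (C_rig = 2) to the basin level 4θ².  UNDECIDED · the N″-core (see §C⁗ header). -/
def OscFlatnessDecay (Λ θ κ₁ κ₀ : ℝ) : Prop :=
  ∀ δ : ℝ, 0 < δ → ∀ S : Set E3, IsDoorSet δ S → (∀ q ∈ S, IsTwoShellAffineGood θ S q) →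
    (∀ R : ℝ, 0 < R → NearHomL2BD Λ κ₁ 4 S (atomsIn (μS S) 0 R)) → ∀ R : ℝ, 0 < R → NearHomL2BD Λ κ₀ 4 S (atomsIn (μS S) 0 R)

/-- D is TRIVIAL downhill: `κ₁ ≤ κ₀ ⇒ OscFlatnessDecay Λ θ κ₁ κ₀` (tree `nearHomL2BD_mono`). -/
theorem oscFlatnessDecay_of_le {Λ θ κ₁ κ₀ : ℝ} (h : κ₁ ≤ κ₀) : OscFlatnessDecay Λ θ κ₁ κ₀ :=
  fun _ _ _ _ _ hF R hR => nearHomL2BD_mono h (hF R hR)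

/-- D is WEAKER than R at the target level: `OscRigidityL2BD Λ θ κ₀ → OscFlatnessDecay Λ θ κ₁ κ₀` (the flatness hypothesis is dropped). -/
theorem oscFlatnessDecay_of_oscRigidity {Λ θ κ₁ κ₀ : ℝ} (h : OscRigidityL2BD Λ θ κ₀) : OscFlatnessDecay Λ θ κ₁ κ₀ :=
  fun δ hδ S hS hO _ R hR => h δ hδ S hS hO R hR

/-- D is WEAKER than lens-3's K_A²_BD at the target level (θ-free): `CleanScaleCoherenceL2BD Λ κ₀ → OscFlatnessDecay Λ θ κ₁ κ₀`. -/
theorem oscFlatnessDecay_of_cleanScaleCoherence {Λ θ κ₁ κ₀ : ℝ} (h : CleanScaleCoherenceL2BD Λ κ₀) : OscFlatnessDecay Λ θ κ₁ κ₀ :=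
  oscFlatnessDecay_of_oscRigidity (oscRigidityL2BD_of_cleanScaleCoherence h)

/-- monotonicity of D: larger start level / larger oscillation = stronger claim; larger target level = weaker claim. -/
theorem OscFlatnessDecay.mono {Λ θ θ' κ₁ κ₁' κ₀ κ₀' : ℝ} (hθ : θ ≤ θ') (h₁ : κ₁ ≤ κ₁') (h₀ : κ₀' ≤ κ₀)
    (h : OscFlatnessDecay Λ θ' κ₁' κ₀') : OscFlatnessDecay Λ θ κ₁ κ₀ :=
  fun δ hδ S hS hO hF R hR =>
    nearHomL2BD_mono h₀ (h δ hδ S hS (fun q hq => (hO q hq).mono hθ) (fun R' hR' => nearHomL2BD_mono h₁ (hF R' hR')) R hR)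

/-- ★ **R(κ₁) ∧ D(κ₁, κ₀) ⟹ R(κ₀)** — the rigidity level and the decay compose to R at the basin level (so every column registered at R(κ₀) is fed
by the honest pair). -/
theorem oscRigidityL2BD_of_decay {Λ θ κ₁ κ₀ : ℝ} (hR : OscRigidityL2BD Λ θ κ₁) (hD : OscFlatnessDecay Λ θ κ₁ κ₀) : OscRigidityL2BD Λ θ κ₀ :=
  fun δ hδ S hS hO R hRpos => hD δ hδ S hS hO (fun R' hR' => hR δ hδ S hS hO R' hR') R hRpos

/-- **the (2b) endpoint of critic row 441**: at κ₁ ≥ 16 the rigidity piece is FREE (`oscRigidityL2BD_of_large`) and D carries everything —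
`1 ≤ Λ → OscFlatnessDecay Λ θ 16 κ₀ → OscRigidityL2BD Λ θ κ₀`; so the ONE decl D spans the placements of row 441 by the choice of κ₁: κ₁ ≥ 16 (all
long-wave exclusion in D; R empty), κ₁ = κ_rig (v8 of record: kinematic rigidity in R, decay below the rigidity level in D), κ₁ = 4θ² (g23's hidden
placement: D trivial, everything in R — withdrawn). -/
theorem oscRigidityL2BD_of_decay_free {Λ θ κ₀ : ℝ} (hΛ : 1 ≤ Λ) (hD : OscFlatnessDecay Λ θ 16 κ₀) : OscRigidityL2BD Λ θ κ₀ :=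
  oscRigidityL2BD_of_decay (oscRigidityL2BD_of_large hΛ le_rfl) hD

/-- **R at the rigidity level is lens-3's K_A²_BD at that level** (θ unused): `CleanScaleCoherenceL2BD 2 (1/16) → OscRigidityL2BD 2 θ (1/16)` — the
registered R(2, θ, 1/16) is PURE GEOMETRIC RIGIDITY (nested radii, R's docstring), no long-wave exclusion. -/
theorem oscRigidity_rig_of_cleanScaleCoherence {θ : ℝ} (h : CleanScaleCoherenceL2BD 2 (1 / 16)) : OscRigidityL2BD 2 θ (1 / 16) :=
  oscRigidityL2BD_of_cleanScaleCoherence h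

/-- ★ **N″(Λ, θ) ⟸ R(κ₁) ∧ D(κ₁, κ₀) ∧ P(κ₀)** — the THREE-piece perturbative transfer (PROVED composition). -/
theorem nonlinearTransferOsc_of_three {Λ θ κ₁ κ₀ : ℝ} (hR : OscRigidityL2BD Λ θ κ₁) (hD : OscFlatnessDecay Λ θ κ₁ κ₀)
    (hP : LinearisedFlatnessExact Λ θ κ₀) : NonlinearTransferOsc Λ θ :=
  nonlinearTransferOsc_of_L2 (oscRigidityL2BD_of_decay hR hD) hP

/-- ★ the (β) column with the shared tolerance honestly placed, PERIODIC-certificate form, SEVEN leaves at the registration literals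
(2, θ = 1/16; κ₁ = 1/16, κ₀ = 1/64): `LJDecay → LJMoments → CleanCrystalStability → R(2,1/16,1/16) → D(2,1/16,1/16,1/64) → P(2,1/16,1/64) → HBG″ →
VisibleGap (1/50) ∧ PertRegime (1/50)`. -/
theorem gap_and_pert_1_50_of_liouville_pieces_L2_16d (hD : LJDecay) (hM : LJMoments) (hC : CleanCrystalStability)
    (hR : OscRigidityL2BD 2 (1 / 16) (1 / 16)) (hDec : OscFlatnessDecay 2 (1 / 16) (1 / 16) (1 / 64))
    (hP : LinearisedFlatnessExact 2 (1 / 16) (1 / 64)) (hG : PeriodicBulkGapDoor 2) : VisibleGap (1 / 50) ∧ PertRegime (1 / 50) :=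
  gap_and_pert_1_50_of_liouville_pieces_L2_16 hD hM hC (oscRigidityL2BD_of_decay hR hDec) hP hG

/-! **NON-VACUITY of L1′♮'s conclusion** (rule NV) is the TREE's `not_twoPeriodic_singleton Λ x : ¬ TwoPeriodic Λ {x}` (…ChartedPlanarOrderDoorLayered):
a single atom is not two-periodic — `DoorPeriodic Λ` is not dischargeable by a degenerate witness (contrast the vacuous `NearHom`-based reading of L1′,
lens-4 g28).  (v8 restated it as `not_twoPeriodic_atom`; v9 cites the tree lemma instead — dedup.) -/

end Summit.AtomisticToContinuum.Crystallization.Theorems.ChartedZeroExcessLayeredLatticeLiouville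

end
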